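import Mathlib
import Summits.MatrixMultiplication.MatrixMultiplication.Theorems.LieRankDesigns.Negative.Basics
import Summits.MatrixMultiplication.MatrixMultiplication.Theorems.SubgroupIdentityDesigns.Negative.TorusCube

/-!
# Radical boxes: tools for the transversal-hosts obstruction (negative lemmas, crux `LieRankDesigns`, 7614)

Elementary tools used by `Negative/TransversalRadicals.lean` (line `subgroup-hosts-one-function` of crux
`LieRankDesigns`, stmt-MatrixMultiplication-7614, stub S3 `stub_transversalIdentityTest` refuted there):
* box orthogonality of `ψ = ZMod.stdAddChar` over `𝔽_p^n` and `M_n(𝔽_p)` (`sum_psi_vec`, `sum_psi_mat`; the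
  one-variable facts `stdAddChar_map_sum`, `sum_psi_mul` are REUSED from `SubgroupIdentityDesigns/Negative/TorusCube`);
* radical elements `[[1,0],[C,1]]` satisfy the host predicate of the line (`isHost_of_radical`) and square-zero
  matrices give units (`exists_unit_one_add`);
* the column space `W' = ⟨e_j : j ≥ k⟩` by coordinates (`mem_coSpan_iff`);
* a biorthogonal `(k+1)`-frame forces `rk M > k` (`lt_rank_of_biorthogonal`), separating vectors
  (`exists_vec_sep`), and the dimension count `W' + g₂W' = 𝔽_p^n ∧ W' ∩ g₂W' ≠ 0 ⇒ 2k < n`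
  (`two_mul_lt_of_transversal`).
All folklore; sorry-free; standard axioms.
-/

set_option linter.dupNamespace false

noncomputable section

open scoped BigOperators
open Matrix

namespace Summit.MatrixMultiplication.MatrixMultiplication.Theorems.LieRankDesigns.Negative

open Summit.MatrixMultiplication.MatrixMultiplication.Theorems.SubgroupIdentityDesigns.Negative
  (stdAddChar_map_sum sum_psi_mul)

variable {p n : ℕ} [Fact p.Prime]

/-! ## Character sums over coordinate boxes -/

/-- Box orthogonality for vectors: `Σ_{θ ∈ 𝔽_p^n} ψ(Σ_t u_t θ_t) = p^n [u = 0]`. [folklore] -/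
theorem sum_psi_vec (u : Fin n → ZMod p) :
    ∑ θ : Fin n → ZMod p, ZMod.stdAddChar (∑ t : Fin n, u t * θ t) =
      if u = 0 then ((p : ℂ) ^ n) else 0 := by
  have hexp : ∀ θ : Fin n → ZMod p, ZMod.stdAddChar (∑ t : Fin n, u t * θ t) =
      ∏ t : Fin n, ZMod.stdAddChar (u t * θ t) := fun θ => stdAddChar_map_sum _ _
  simp_rw [hexp]
  rw [← Fintype.prod_sum (fun t (x : ZMod p) => ZMod.stdAddChar (u t * x))]
  simp_rw [sum_psi_mul]
  split_ifs with hu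
  · subst hu
    simp
  · obtain ⟨t, ht⟩ := Function.ne_iff.mp hu
    apply Finset.prod_eq_zero (Finset.mem_univ t)
    rw [if_neg (by simpa using ht)]

/-- Box orthogonality for matrices: `Σ_{T ∈ M_n(𝔽_p)} ψ(Σ_{i,j} a_{ij} T_{ij}) = p^{n·n} [a = 0]`. [folklore] -/
theorem sum_psi_mat (a : Fin n → Fin n → ZMod p) :
    ∑ T : Fin n → Fin n → ZMod p, ZMod.stdAddChar (∑ i : Fin n, ∑ j : Fin n, a i j * T i j) =
      if a = 0 then ((p : ℂ) ^ (n * n)) else 0 := by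
  have hexp : ∀ T : Fin n → Fin n → ZMod p, ZMod.stdAddChar (∑ i : Fin n, ∑ j : Fin n, a i j * T i j) =
      ∏ i : Fin n, ZMod.stdAddChar (∑ j : Fin n, a i j * T i j) := fun T => stdAddChar_map_sum _ _
  simp_rw [hexp]
  rw [← Fintype.prod_sum (fun i (r : Fin n → ZMod p) => ZMod.stdAddChar (∑ j : Fin n, a i j * r j))]
  simp_rw [sum_psi_vec]
  split_ifs with ha
  · subst ha
    simp [pow_mul]
  · obtain ⟨i, hi⟩ := Function.ne_iff.mp ha
    apply Finset.prod_eq_zero (Finset.mem_univ i)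
    rw [if_neg (by simpa using hi)]

/-! ## Radical elements are hosts, and are units -/

/-- A block-lower unipotent matrix `g = [[1, 0], [C, 1]]` (blocks `k`, `n − k`) satisfies the host predicate of line
`subgroup-hosts-one-function` (columns `j ≥ k` standard; top-left block `= 1`, so the Levi off-diagonal entries vanish
and the padded first block is the identity, whose determinant `1` is a square). -/
theorem isHost_of_radical (k : ℕ) (g : Mat p n)
    (hg : ∀ i j : Fin n, ((i : ℕ) < k ∨ k ≤ (j : ℕ)) → g i j = (1 : Mat p n) i j) :
    (∀ i j : Fin n, k ≤ (j : ℕ) → g i j = (1 : Mat p n) i j) ∧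
    (∀ i j : Fin n, (i : ℕ) < k → (j : ℕ) < k → ((i : ℕ) < k / 2 ↔ k / 2 ≤ (j : ℕ)) → g i j = 0) ∧
    IsSquare (Matrix.det (Matrix.of fun i j : Fin n =>
      if (i : ℕ) < k / 2 ∧ (j : ℕ) < k / 2 then g i j else (1 : Mat p n) i j)) := by
  refine ⟨fun i j hj => hg i j (Or.inr hj), fun i j hi _ hij => ?_, ?_⟩
  · rw [hg i j (Or.inl hi), Matrix.one_apply, if_neg]
    rintro rfl
    rcases lt_or_ge (i : ℕ) (k / 2) with h | h
    · exact absurd (hij.1 h) (by omega)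
    · exact absurd (hij.2 h) (by omega)
  · have hmat : (Matrix.of fun i j : Fin n =>
        if (i : ℕ) < k / 2 ∧ (j : ℕ) < k / 2 then g i j else (1 : Mat p n) i j) = 1 := by
      ext i j
      simp only [Matrix.of_apply]
      split_ifs with h
      · exact hg i j (Or.inl (lt_of_lt_of_le h.1 (Nat.div_le_self k 2)))
      · rfl
    rw [hmat, Matrix.det_one]
    exact ⟨1, (mul_one 1).symm⟩

/-- A square-zero matrix `N` gives the unit `1 + N` (inverse `1 − N`). [folklore] -/
theorem exists_unit_one_add (N : Mat p n) (hN : N * N = 0) : ∃ u : GLm p n, (u : Mat p n) = 1 + N := by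
  refine ⟨⟨1 + N, 1 - N, ?_, ?_⟩, rfl⟩
  · rw [add_mul, mul_sub, mul_sub, one_mul, one_mul, mul_one, hN]; abel
  · rw [sub_mul, mul_add, mul_add, one_mul, one_mul, mul_one, hN]; abel

/-! ## The column space `W' = ⟨e_j : j ≥ k⟩` -/

/-- Membership in `W' = span{e_j : j ≥ k}`: exactly the vectors whose first `k` coordinates vanish. [folklore] -/
theorem mem_coSpan_iff (k : ℕ) (v : Fin n → ZMod p) :
    v ∈ Submodule.span (ZMod p) (Set.range fun j : {j : Fin n // k ≤ (j : ℕ)} => Pi.single (j : Fin n) (1 : ZMod p))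
      ↔ ∀ i : Fin n, (i : ℕ) < k → v i = 0 := by
  constructor
  · intro hv
    induction hv using Submodule.span_induction with
    | mem x hx =>
        obtain ⟨j, rfl⟩ := hx
        intro i hi
        have hij : (i : Fin n) ≠ j := fun h => by
          have := j.2; rw [← h] at this; omega
        simp [hij]
    | zero => intro i _; rfl
    | add x y _ _ hx hy => intro i hi; simp [hx i hi, hy i hi]
    | smul r x _ hx => intro i hi; simp [hx i hi]
  · intro hv
    rw [pi_eq_sum_univ' v]
    refine Submodule.sum_mem _ fun i _ => ?_
    by_cases hi : (i : ℕ) < k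
    · rw [hv i hi, zero_smul]; exact Submodule.zero_mem _
    · refine Submodule.smul_mem _ _ (Submodule.subset_span ⟨⟨i, not_lt.1 hi⟩, rfl⟩)


/-! ## Linear algebra: a biorthogonal `(k+1)`-frame forces rank `> k`; separating vectors; dimension count -/

/-- If `x_a ⬝ (M y_b) = [a = b]` for `a, b < k + 1` then `rk M ≥ k + 1` (`X M Y = 1_{k+1}`, `rank_mul_le_*`). [folklore] -/
theorem lt_rank_of_biorthogonal (k : ℕ) (M : Mat p n) (x y : Fin (k + 1) → (Fin n → ZMod p))
    (h : ∀ a b : Fin (k + 1), x a ⬝ᵥ (M *ᵥ y b) = if a = b then 1 else 0) : k < M.rank := by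
  classical
  set X : Matrix (Fin (k + 1)) (Fin n) (ZMod p) := Matrix.of fun a i => x a i with hX
  set Y : Matrix (Fin n) (Fin (k + 1)) (ZMod p) := Matrix.of fun j b => y b j with hY
  have hXMY : X * M * Y = 1 := by
    ext a b
    have hab : (X * M * Y) a b = x a ⬝ᵥ (M *ᵥ y b) := by
      rw [dotProduct_mulVec]
      simp only [Matrix.mul_apply, dotProduct, Matrix.vecMul, hX, hY, Matrix.of_apply]
    rw [hab, h, Matrix.one_apply]
  have h1 : (X * M * Y).rank = k + 1 := by
    rw [hXMY, Matrix.rank_one, Fintype.card_fin]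
  have h2 : (X * M * Y).rank ≤ M.rank :=
    (Matrix.rank_mul_le_left _ _).trans (Matrix.rank_mul_le_right _ _)
  omega

/-- A vector outside a subspace is separated from it by a coordinate functional vector `φ`
(`φ ⬝ w₀ = 1`, `φ ⬝ W = 0`). [folklore; `Submodule.exists_dual_map_eq_bot_of_notMem`] -/
theorem exists_vec_sep (W : Submodule (ZMod p) (Fin n → ZMod p)) (w₀ : Fin n → ZMod p) (hw₀ : w₀ ∉ W) :
    ∃ φ : Fin n → ZMod p, φ ⬝ᵥ w₀ = 1 ∧ ∀ w ∈ W, φ ⬝ᵥ w = 0 := by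
  classical
  obtain ⟨f, hf0, hfW⟩ := Submodule.exists_dual_map_eq_bot_of_notMem hw₀ inferInstance
  have hf : ∀ w : Fin n → ZMod p,
      (fun i => (f w₀)⁻¹ * f (fun j => if i = j then 1 else 0)) ⬝ᵥ w = (f w₀)⁻¹ * f w := by
    intro w
    rw [LinearMap.pi_apply_eq_sum_univ f w, Finset.mul_sum]
    simp only [dotProduct, smul_eq_mul]
    refine Finset.sum_congr rfl fun i _ => by ring
  refine ⟨fun i => (f w₀)⁻¹ * f (fun j => if i = j then 1 else 0), ?_, fun w hw => ?_⟩
  · rw [hf, inv_mul_cancel₀ hf0]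
  · have hmem : f w ∈ W.map f := Submodule.mem_map_of_mem hw
    rw [hfW, Submodule.mem_bot] at hmem
    rw [hf, hmem, mul_zero]

/-- `#{j < n : k ≤ j} ≤ n − k`. [folklore] -/
theorem card_subtype_ge_le (k : ℕ) : Fintype.card {j : Fin n // k ≤ (j : ℕ)} ≤ n - k := by
  have h : Fintype.card {j : Fin n // k ≤ (j : ℕ)} ≤ Fintype.card (Fin (n - k)) :=
    Fintype.card_le_of_injective
      (fun j => ⟨((j : Fin n) : ℕ) - k, by have h1 := (j : Fin n).isLt; have h2 := j.2; omega⟩)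
      (fun a b hab => by
        apply Subtype.ext
        apply Fin.ext
        simp only [Fin.mk.injEq] at hab
        have ha := a.2
        have hb := b.2
        omega)
  simpa using h

/-- The dimension count behind transversality: `W' + g₂W' = 𝔽_p^n` with `W' ∩ g₂W' ≠ 0` forces `2k < n`
(`n + dim(W' ∩ g₂W') = dim W' + dim g₂W' ≤ 2(n − k)`). [folklore] -/
theorem two_mul_lt_of_transversal (k : ℕ) (g₂ : GLm p n)
    (htop : Submodule.span (ZMod p) (Set.range fun j : {j : Fin n // k ≤ (j : ℕ)} => Pi.single (j : Fin n) (1 : ZMod p)) ⊔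
        (Submodule.span (ZMod p)
          (Set.range fun j : {j : Fin n // k ≤ (j : ℕ)} => Pi.single (j : Fin n) (1 : ZMod p))).map
          (Matrix.toLin' (g₂ : Mat p n)) = ⊤)
    (hne : Submodule.span (ZMod p) (Set.range fun j : {j : Fin n // k ≤ (j : ℕ)} => Pi.single (j : Fin n) (1 : ZMod p)) ⊓
        (Submodule.span (ZMod p)
          (Set.range fun j : {j : Fin n // k ≤ (j : ℕ)} => Pi.single (j : Fin n) (1 : ZMod p))).map
          (Matrix.toLin' (g₂ : Mat p n)) ≠ ⊥) :
    2 * k < n := by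
  set W : Submodule (ZMod p) (Fin n → ZMod p) :=
    Submodule.span (ZMod p) (Set.range fun j : {j : Fin n // k ≤ (j : ℕ)} => Pi.single (j : Fin n) (1 : ZMod p))
    with hW
  have hsum := Submodule.finrank_sup_add_finrank_inf_eq W (W.map (Matrix.toLin' (g₂ : Mat p n)))
  rw [htop, finrank_top, Module.finrank_fintype_fun_eq_card, Fintype.card_fin] at hsum
  have h1 : Module.finrank (ZMod p) W ≤ n - k :=
    (finrank_range_le_card _).trans (card_subtype_ge_le k)
  have h2 : Module.finrank (ZMod p) (W.map (Matrix.toLin' (g₂ : Mat p n))) ≤ Module.finrank (ZMod p) W :=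
    Submodule.finrank_map_le _ _
  have h3 : Module.finrank (ZMod p) ↥(W ⊓ W.map (Matrix.toLin' (g₂ : Mat p n))) ≠ 0 := by
    rwa [Ne, Submodule.finrank_eq_zero]
  omega

end Summit.MatrixMultiplication.MatrixMultiplication.Theorems.LieRankDesigns.Negative

end
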